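import Literature.AlgebraicGeometry.HodgeTheory.AbelianVarietyEndomorphismsHOne
import Literature.AlgebraicGeometry.HodgeTheory.WeilClassesCyclicPrymTyping
import Literature.AlgebraicGeometry.Motives.AbelianVarietyCohomologyExteriorH1
import Summits.HodgeConjecture.HodgeConjecture.Theorems.WeilTenfoldsSqrtMinus11.Negative.EigenvalueSeparation
import HarnessLib

/-!
# Route HeckePrymWeil · crux `WeilTenfoldsSqrtMinus11` (stmt-HodgeConjecture-1262) · line
# `quaternionic-norm-anchors` · stub `stub_weilPlaneTyping` (T, typing bridge) — CLOSED, unconditional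

The crux types the complexified Weil plane of a tenfold `(A, φ)`, `φ ≫ φ = -11`, with ONE pull-back:
`Eig((𝟙 + φ)^*, (1 ± i√11)¹⁰) ⊆ H¹⁰(A(ℂ); ℂ)`. The tree's Weil-class API (`HodgeTheory/WeilClasses`:
`weilClassesPlus/Minus A φ 5 11`, the joint eigenclasses of ALL the test pull-backs `(x·𝟙 + y·φ)^*`,
`x y : ℕ`, with characters `(x ± y·i√11)¹⁰`) is where every theorem about Weil classes lives. This
file proves the bridge, even as EQUALITIES: `Eig((𝟙 + φ)^*, (1 ± i√11)¹⁰) = weilClassesPlus/Minus A φ 5 11`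
(van Geemen, LNM 1594, proof of Thm. 6.12: in the wedge eigenbasis of `H¹⁰ = ⋀¹⁰ H¹`,
`H¹ = V₊ ⊕ V₋`, the pull-back `(𝟙 + φ)^*` acts on `⋀ᵃ V₊ ⊗ ⋀ᵇ V₋` by `(1 + i√11)ᵃ (1 - i√11)ᵇ`, which is
`(1 + i√11)¹⁰` only for `b = 0` and `(1 - i√11)¹⁰` only for `a = 0`). The two ingredients are in the
tree: the single-operator typing theorem
`HodgeTheory.eigenspace_map_nsmul_id_add_nsmul_eq_pullbackEigenclasses` (`WeilClassesCyclicPrymTyping`,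
fed with the PROVED `Motives.abelianVarietyCohomologyExteriorH1_holds`, `H•(A(ℂ); ℂ) = ⋀• H¹`) and the
LANDED eigenvalue separation `weil11_mixed_ne_plus` / `weil11_mixed_ne_minus`
(`Theorems/WeilTenfoldsSqrtMinus11/Negative/EigenvalueSeparation`). VERBATIM the registered stub
`stub_weilPlaneTyping` of the skeleton `Lines/quaternionic-norm-anchors.lean`; the dimension
hypothesis `A.dim = 10` of the registered signature is not even needed.
-/

noncomputable section

-- single-problem summit (Problem = Summit): the mandated namespace repeats `HodgeConjecture`.
set_option linter.dupNamespace false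

open CategoryTheory AlgebraicGeometry
open Literature.AlgebraicGeometry.Motives Literature.AlgebraicGeometry.HodgeTheory
open Literature.AlgebraicTopology.SingularHomology

namespace Summit.HodgeConjecture.HodgeConjecture.Theorems.HeckePrymWeil

open Summit.HodgeConjecture.HodgeConjecture.Theorems.WeilTenfoldsSqrtMinus11.Negative

/-- **Separation in degree `10` for the test endomorphism `1·𝟙 + 1·φ`**, `μ = ± i√11`:
`(1 + μ)ᵃ (1 - μ)ᵇ ≠ (1 + μ)¹⁰` whenever `a + b = 10`, `b ≥ 1` — the hypothesis of
`eigenspace_map_nsmul_id_add_nsmul_eq_pullbackEigenclasses`, in its literal `ℕ`-cast shape; both signs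
are the landed `weil11_mixed_ne_plus` / `weil11_mixed_ne_minus` (`(1 + i√11)ᵇ ∉ ℤ` for `b ≥ 1`).
[folklore] -/
theorem separation_one_add_sqrt_minus_eleven (μ : ℂ)
    (hμ : μ = Complex.I * (Real.sqrt (11 : ℝ) : ℂ) ∨ μ = -(Complex.I * (Real.sqrt (11 : ℝ) : ℂ))) :
    ∀ a b : ℕ, a + b = 2 * 5 → 0 < b →
      (((1 : ℕ) : ℂ) + ((1 : ℕ) : ℂ) * μ) ^ a * (((1 : ℕ) : ℂ) - ((1 : ℕ) : ℂ) * μ) ^ b ≠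
        (((1 : ℕ) : ℂ) + ((1 : ℕ) : ℂ) * μ) ^ (2 * 5) := by
  intro a b hab hb h
  simp only [Nat.cast_one, one_mul] at h
  rcases hμ with rfl | rfl
  · exact weil11_mixed_ne_plus a b hab hb h
  · -- `μ = -i√11`: `1 + μ = 1 - i√11`, `1 - μ = 1 + i√11`; swap the two factors
    have e₁ : (1 : ℂ) + -(Complex.I * (Real.sqrt (11 : ℝ) : ℂ)) =
        1 - Complex.I * (Real.sqrt (11 : ℝ) : ℂ) := by rw [sub_eq_add_neg]
    have e₂ : (1 : ℂ) - -(Complex.I * (Real.sqrt (11 : ℝ) : ℂ)) =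
        1 + Complex.I * (Real.sqrt (11 : ℝ) : ℂ) := by rw [sub_neg_eq_add]
    rw [e₁, e₂, mul_comm] at h
    exact weil11_mixed_ne_minus b a (by omega) hb h

/-- **`Eig((𝟙 + φ)^*|H¹⁰, (1 + i√11)¹⁰) = E₊ = weilClassesPlus A φ 5 11`** for every endomorphism `φ`
of a complex abelian variety `A` with `φ ≫ φ = -11` (no dimension hypothesis): the crux's literal
`+`-eigenspace IS the tree's `+`-Weil line `⋀¹⁰ V₊` (van Geemen, proof of Thm. 6.12; the tree's
`eigenspace_map_nsmul_id_add_nsmul_eq_pullbackEigenclasses` with `H•(A(ℂ)) = ⋀• H¹`,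
`abelianVarietyCohomologyExteriorH1_holds`, and the separation `weil11_mixed_ne_plus`).
[cite: vanGeemen1994HodgeAV, proof of Thm. 6.12] -/
theorem eigenspace_one_add_eq_weilClassesPlus (A : AbelianVariety ℂ) {φ : A ⟶ A}
    (hφ : φ ≫ φ = -(11 • 𝟙 A)) :
    Module.End.eigenspace (complexBetti.map (𝟙 A + φ).hom.hom.hom (2 * 5)).hom
        ((1 + Complex.I * (Real.sqrt (11 : ℝ) : ℂ)) ^ 10) = weilClassesPlus A φ 5 11 := by
  have h := eigenspace_map_nsmul_id_add_nsmul_eq_pullbackEigenclasses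
    (abelianVarietyCohomologyExteriorH1_holds.hasExteriorCohomologyH1 A) (n := 5) (d := 11)
    (by norm_num) hφ (μ := Complex.I * (Real.sqrt (11 : ℝ) : ℂ)) (Or.inl rfl) 1 1
    (separation_one_add_sqrt_minus_eleven _ (Or.inl rfl))
  have hop : (𝟙 A + φ : A ⟶ A) = (1 : ℕ) • 𝟙 A + (1 : ℕ) • φ := by rw [one_smul, one_smul]
  have hval : (1 + Complex.I * (Real.sqrt (11 : ℝ) : ℂ)) ^ 10 =
      (((1 : ℕ) : ℂ) + ((1 : ℕ) : ℂ) * (Complex.I * (Real.sqrt (11 : ℝ) : ℂ))) ^ (2 * 5) := by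
    rw [Nat.cast_one, one_mul]
  have e : (fun x y : ℕ => ((x : ℂ) + (y : ℂ) * Complex.I * (Real.sqrt ((11 : ℕ) : ℝ) : ℂ)) ^ (2 * 5)) =
      fun x y : ℕ => ((x : ℂ) + (y : ℂ) * (Complex.I * (Real.sqrt ((11 : ℕ) : ℝ) : ℂ))) ^ (2 * 5) := by
    funext x y; rw [mul_assoc]
  rw [hop, hval]
  -- `√(11 : ℝ)` versus `√((11 : ℕ) : ℝ)`: definitionally equal numerals
  exact h.trans (by rw [weilClassesPlus, e]; rfl)

/-- **`Eig((𝟙 + φ)^*|H¹⁰, (1 - i√11)¹⁰) = E₋ = weilClassesMinus A φ 5 11`** (`= ⋀¹⁰ V₋`), for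
`φ ≫ φ = -11` on any complex abelian variety (separation `weil11_mixed_ne_minus`).
[cite: vanGeemen1994HodgeAV, proof of Thm. 6.12] -/
theorem eigenspace_one_add_eq_weilClassesMinus (A : AbelianVariety ℂ) {φ : A ⟶ A}
    (hφ : φ ≫ φ = -(11 • 𝟙 A)) :
    Module.End.eigenspace (complexBetti.map (𝟙 A + φ).hom.hom.hom (2 * 5)).hom
        ((1 - Complex.I * (Real.sqrt (11 : ℝ) : ℂ)) ^ 10) = weilClassesMinus A φ 5 11 := by
  have h := eigenspace_map_nsmul_id_add_nsmul_eq_pullbackEigenclasses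
    (abelianVarietyCohomologyExteriorH1_holds.hasExteriorCohomologyH1 A) (n := 5) (d := 11)
    (by norm_num) hφ (μ := -(Complex.I * (Real.sqrt (11 : ℝ) : ℂ))) (Or.inr rfl) 1 1
    (separation_one_add_sqrt_minus_eleven _ (Or.inr rfl))
  have hop : (𝟙 A + φ : A ⟶ A) = (1 : ℕ) • 𝟙 A + (1 : ℕ) • φ := by rw [one_smul, one_smul]
  have hval : (1 - Complex.I * (Real.sqrt (11 : ℝ) : ℂ)) ^ 10 =
      (((1 : ℕ) : ℂ) + ((1 : ℕ) : ℂ) * (-(Complex.I * (Real.sqrt (11 : ℝ) : ℂ)))) ^ (2 * 5) := by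
    rw [Nat.cast_one, one_mul, ← sub_eq_add_neg]
  have e : (fun x y : ℕ => ((x : ℂ) - (y : ℂ) * Complex.I * (Real.sqrt ((11 : ℕ) : ℝ) : ℂ)) ^ (2 * 5)) =
      fun x y : ℕ => ((x : ℂ) + (y : ℂ) * (-(Complex.I * (Real.sqrt ((11 : ℕ) : ℝ) : ℂ)))) ^ (2 * 5) := by
    funext x y; rw [mul_neg, ← sub_eq_add_neg, mul_assoc]
  rw [hop, hval]
  exact h.trans (by rw [weilClassesMinus, e]; rfl)

/-- **Stub T `stub_weilPlaneTyping`, CLOSED** (typing bridge). For an abelian tenfold `A` with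
`φ ≫ φ = -11`, the crux's LITERAL eigenspaces `Eig((𝟙 + φ)^*, (1 ± i√11)¹⁰) ⊆ H¹⁰(A(ℂ); ℂ)` lie in
the tree's Weil lines `weilClassesPlus/Minus A φ 5 11` — in fact they are equal to them
(`eigenspace_one_add_eq_weilClassesPlus/Minus`: `H¹⁰ = ⋀¹⁰ H¹`, van Geemen's wedge eigenbasis, and
the eigenvalue separation `(1 + i√11)ᵃ (1 - i√11)ᵇ ≠ (1 ± i√11)¹⁰` for mixed `(a, b)`). The
hypothesis `A.dim = 10` is not used. [cite: vanGeemen1994HodgeAV, proof of Thm. 6.12] -/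
theorem stub_weilPlaneTyping :
    ∀ (A : AbelianVariety ℂ) (φ : A ⟶ A), A.dim = 10 → φ ≫ φ = -((11 : ℤ) • 𝟙 A) →
      Module.End.eigenspace (complexBetti.map (𝟙 A + φ).hom.hom.hom (2 * 5)).hom
          ((1 + Complex.I * (Real.sqrt (11 : ℝ) : ℂ)) ^ 10) ≤ weilClassesPlus A φ 5 11 ∧
      Module.End.eigenspace (complexBetti.map (𝟙 A + φ).hom.hom.hom (2 * 5)).hom
          ((1 - Complex.I * (Real.sqrt (11 : ℝ) : ℂ)) ^ 10) ≤ weilClassesMinus A φ 5 11 := by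
  intro A φ _ hφ
  have hφ' : φ ≫ φ = -((11 : ℕ) • 𝟙 A) := by rw [hφ, ← natCast_zsmul]; rfl
  exact ⟨(eigenspace_one_add_eq_weilClassesPlus A hφ').le,
    (eigenspace_one_add_eq_weilClassesMinus A hφ').le⟩

end Summit.HodgeConjecture.HodgeConjecture.Theorems.HeckePrymWeil

end
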